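import Summits.QuantumFields.YangMills.Theorems.IR.Negative.OnsetFormatsUcTransfer
import HarnessLib

/-!
# Crux `IR` (stmt-QuantumFields-19354), line `af-pincer-Uc`: the universal shell condition from WINDOW-agreement mixing,
# and the STRONG-COUPLING CALIBRATION — format Uc holds at mesh 1, window 1, every `δ`, for `|β| ≤ β_D(ε)`

Helper module for item `stmt-QuantumFields-19354` (`--supports`; it closes nothing); lead prover of the line.  Written
against the disprover's tree mirrors `OnsetFormats.UnivShellCond` (slot g0 :82 verbatim) and `OnsetFormatsUc.TypShellCondUKPc`
(slot Uc :222 verbatim; `= AfPincerUc.TypShellCondUKPc` by `AfPincerUc.typShellCondUKPc_iff_mirror`), so it is route-independent.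

WHAT IS HERE (all proved; no `sorry`; axioms ⊆ {propext, Classical.choice, Quot.sound}).
* §1 `univShellCond_of_windowAgreement` — a format bridge: mixing `≤ ε` for ALL pairs of exterior data that AGREE ON THE
  WHOLE WINDOW (the shape of `CertificationLength.CompleteAnalyticityAtLargeScales` / `FiniteSizeCriterion` / the strong
  rung `stub_rung_strong_proved`) implies `UnivShellCond` (agreement demanded only on the window cells off `Y`): glue the
  second datum into the first on the resampled links (`ShellTempered.ymSpecification_congr_off` — the kernel never reads
  its exterior datum on the region it resamples).
* §2 `univShellCond_one_one_of_smallBeta` — for every compact `G`, continuous `ρ` and `ε > 0` there is `β_D > 0` with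
  `UnivShellCond ρ β 1 1 ε` for all `|β| ≤ β_D`: the density-ratio estimate of the strong rung
  (`Tempered.ratio_bounds` / `exp_gap_le` / `abs_sub_le_of_bounds`, Georgii Def. 2.9 / high temperature), re-run WITHOUT any
  agreement hypothesis (it never used one) — adapted from `Theorems/BalabanLadderIRStubRungStrong` §5.
* §3 `typShellCondUKPc_one_one_of_smallBeta` — hence format Uc at `(b, n) = (1, 1)` for EVERY `δ` in the strong-coupling
  window (`OnsetFormatsUc.typShellCondUKPc_of_univShellCond`, class `Typ ≡ univ`), and `one_mem_fmtSetUc_of_smallBeta`: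
  mesh `1` is a Uc-mixing mesh there, so the Uc onset `mixOnsetUc ρ β 1 ε δ` equals `1` for `|β| ≤ β_D(ε)` (a calibration
  endpoint of the onset curve; the onset statement itself concerns `β → ∞`, where R66 forces `b⋆ → ∞`).

HONEST FRAMING: strong-coupling bookkeeping (high-temperature Dobrushin regime at the smallest mesh) and a format bridge;
says nothing about the weak-coupling onset, clause (i) at `β → ∞`, the gap or Clay.
-/

set_option autoImplicit false

noncomputable section

open MeasureTheory
open Literature.MathematicalPhysics
open Literature.MathematicalPhysics.QuantumFieldTheory Literature.MathematicalPhysics.QuantumLattice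
open Literature.Probability.LatticeModels
open Summit.QuantumFields.YangMills.Cruxes.IR.Tempered (cellEdges windowCells regionEdges ratio_bounds exp_gap_le
  abs_sub_le_of_bounds integral_ymSpecification_of_continuous card_regionEdges_le cellEdges_subset_regionEdges
  measurable_wilsonWeight_of_continuous)
open Summit.QuantumFields.YangMills.Cruxes.IR.ShellTempered (windowCellsPlus ymSpecification_congr_off)
open Summit.QuantumFields.YangMills.Cruxes.IR.OnsetFormats (UnivShellCond)
open Summit.QuantumFields.YangMills.Cruxes.IR.OnsetFormatsUc (TypShellCondUKPc typShellCondUKPc_of_univShellCond)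

namespace Summit.QuantumFields.YangMills.Cruxes.IR.AfPincerUc.Calibration

variable {G : Type} [Group G] [TopologicalSpace G] [IsTopologicalGroup G] [CompactSpace G]
  [MeasurableSpace G] [BorelSpace G] {N : ℕ} (ρ : G →* Matrix (Fin N) (Fin N) ℂ)

/-! ## §1 Window-agreement mixing ⇒ the universal shell condition -/

omit [TopologicalSpace G] [IsTopologicalGroup G] [CompactSpace G] [MeasurableSpace G] [BorelSpace G] in
/-- Window cells are window-plus-shell cells. -/
theorem windowCells_subset_windowCellsPlus (n : ℕ) : windowCells n ⊆ windowCellsPlus n := by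
  intro c hc
  simp only [Summit.QuantumFields.YangMills.Cruxes.IR.Tempered.windowCells,
    Summit.QuantumFields.YangMills.Cruxes.IR.ShellTempered.windowCellsPlus, Fintype.mem_piFinset, Finset.mem_Icc] at hc ⊢
  intro i
  have h := hc i
  constructor <;> omega

/-- **Format bridge.**  Mixing `≤ ε` at `(β, b, n)` for all exterior pairs AGREEING ON THE WHOLE WINDOW implies
`UnivShellCond ρ β b n ε` (agreement only on the window cells off `Y`): the kernel of `regionEdges w Y` does not read its
datum on `regionEdges w Y`, so the second datum may be glued into the first there. -/
theorem univShellCond_of_windowAgreement {β : ℝ} {b n : ℕ} {ε : ℝ}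
    (h : ∀ w : Fin 4 → ℤ → ℤ, (∀ i j, w i j + ((b : ℕ) : ℤ) ≤ w i (j + 1) ∧ w i (j + 1) ≤ w i j + 2 * ((b : ℕ) : ℤ)) →
      ∀ Y : Finset (Fin 4 → ℤ), Y ⊆ windowCells n → (0 : Fin 4 → ℤ) ∈ Y →
        ∀ σ σ' : LGConfig 4 G, (∀ e ∈ regionEdges w (windowCells n), σ e = σ' e) →
          ∀ f : LGConfig 4 G → ℝ, IsCylinder f (cellEdges w 0) → Measurable f → (∀ U, 0 ≤ f U ∧ f U ≤ 1) →
            |(∫ U, f U ∂(ymSpecification ρ β (regionEdges w Y) σ)) -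
              ∫ U, f U ∂(ymSpecification ρ β (regionEdges w Y) σ')| ≤ ε) :
    UnivShellCond ρ β b n ε := by
  classical
  intro w hw Y hY h0 σ σ' hagree f hf hfm hf01
  -- glue `σ` into `σ'` on the resampled links
  let σ'' : LGConfig 4 G := fun e => if e ∈ regionEdges w Y then σ e else σ' e
  have hoff : ∀ e ∉ regionEdges w Y, σ'' e = σ' e := fun e he => by simp [σ'', he]
  have hγ : ymSpecification ρ β (regionEdges w Y) σ'' = ymSpecification ρ β (regionEdges w Y) σ' :=
    ymSpecification_congr_off ρ β (regionEdges w Y) hoff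
  have hwin : ∀ e ∈ regionEdges w (windowCells n), σ e = σ'' e := by
    intro e he
    by_cases heY : e ∈ regionEdges w Y
    · simp [σ'', heY]
    · simp only [σ'', heY, if_false]
      obtain ⟨c, hc, hec⟩ := Finset.mem_biUnion.1 he
      have hcY : c ∉ Y := fun hcY => heY (Finset.mem_biUnion.2 ⟨c, hcY, hec⟩)
      exact hagree c (windowCells_subset_windowCellsPlus n hc) hcY hc e hec
  rw [← hγ]
  exact h w hw Y hY h0 σ σ'' hwin f hf hfm hf01

/-! ## §2 Strong coupling: the universal shell condition at mesh `1`, window `1` -/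

/-- **Strong-coupling calibration.**  For every compact `G`, continuous `ρ` and `ε > 0` there is `β_D > 0` such that
`UnivShellCond ρ β 1 1 ε` for all `|β| ≤ β_D`: every mesh-1 kernel region inside the radius-2 window forgets its exterior
datum up to `ε` (density-ratio estimate; no agreement hypothesis is needed).  Adapted from the strong rung
`Tempered.stub_rung_strong_proved` (same constants: `β_D = min (1/(2K)) (ε/(8K))`, `K = (N + C)·P + 1`). -/
theorem univShellCond_one_one_of_smallBeta (hρ : Continuous ρ) {ε : ℝ} (hε : 0 < ε) :
    ∃ β_D : ℝ, 0 < β_D ∧ ∀ β : ℝ, |β| ≤ β_D → UnivShellCond ρ β 1 1 ε := by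
  obtain ⟨C, hC0, hC⟩ := Literature.MathematicalPhysics.QuantumLattice.exists_forall_abs_plaquetteObs_le (d := 4) ρ hρ
  set P : ℕ := (1 + 4) * Fintype.card {p : Fin 4 × Fin 4 // p.1 < p.2} * 40000 with hP
  set K : ℝ := ((N : ℝ) + C) * P + 1 with hK
  have hNC : 0 ≤ (N : ℝ) + C := by positivity
  have hKpos : 0 < K := by positivity
  refine ⟨min (1 / (2 * K)) (ε / (8 * K)), lt_min (by positivity) (by positivity), fun β hβ => ?_⟩
  have hβ1 : |β| ≤ 1 / (2 * K) := hβ.trans (min_le_left _ _)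
  have hβ2 : |β| ≤ ε / (8 * K) := hβ.trans (min_le_right _ _)
  intro w hw Y hY h0Y η η' _ f hf_cyl hfm hf01
  set Λ : Finset (QuantumLattice.ZdEdge 4) := regionEdges w Y with hΛ
  have hcardΛ : Λ.card ≤ 40000 := card_regionEdges_le w hw Y hY
  have hcardP : (plaquettesTouching Λ).card ≤ P :=
    (Literature.MathematicalPhysics.QuantumLattice.card_plaquettesTouching_le Λ).trans (Nat.mul_le_mul_left _ hcardΛ)
  set A : ℝ := |β| * (((N : ℝ) + C) * (plaquettesTouching Λ).card) with hA
  have hA0 : 0 ≤ A := by positivity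
  have hAK : A ≤ |β| * K := by
    refine mul_le_mul_of_nonneg_left ?_ (abs_nonneg β)
    have : ((N : ℝ) + C) * (plaquettesTouching Λ).card ≤ ((N : ℝ) + C) * P :=
      mul_le_mul_of_nonneg_left (by exact_mod_cast hcardP) hNC
    linarith
  have hβK1 : |β| * K ≤ 1 / 2 := by
    calc |β| * K ≤ 1 / (2 * K) * K := mul_le_mul_of_nonneg_right hβ1 hKpos.le
      _ = 1 / 2 := by field_simp
  have hβK2 : |β| * K ≤ ε / 8 := by
    calc |β| * K ≤ ε / (8 * K) * K := mul_le_mul_of_nonneg_right hβ2 hKpos.le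
      _ = ε / 8 := by field_simp
  have h2A : 2 * A ≤ 1 := by linarith
  have h8A : 8 * A ≤ ε := by linarith
  -- the weight and its two-sided bound
  have hwt : ∀ U : LGConfig 4 G, Real.exp (-A) ≤ Real.exp (-β * wilsonBoundaryAction ρ Λ U) ∧
      Real.exp (-β * wilsonBoundaryAction ρ Λ U) ≤ Real.exp A := by
    intro U
    have hS := Literature.MathematicalPhysics.QuantumLattice.abs_wilsonBoundaryAction_le ρ hC Λ U
    have hb : |-β * wilsonBoundaryAction ρ Λ U| ≤ A := by
      rw [abs_mul, abs_neg]
      exact mul_le_mul_of_nonneg_left hS (abs_nonneg β)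
    rw [abs_le] at hb
    exact ⟨Real.exp_le_exp.2 hb.1, Real.exp_le_exp.2 hb.2⟩
  have hwm : ∀ ξ : LGConfig 4 G, Measurable fun ζ : ↥Λ → G =>
      Real.exp (-β * wilsonBoundaryAction ρ Λ (glueWith Λ ζ ξ)) := fun ξ =>
    (measurable_wilsonWeight_of_continuous ρ hρ β Λ).comp (measurable_glueWith Λ ξ)
  -- the kernel expectations as density ratios over the product Haar measure
  set π : Measure (↥Λ → G) := Measure.pi fun _ : ↥Λ => haarProbability G with hπ
  haveI : IsProbabilityMeasure π := by rw [hπ]; infer_instance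
  rw [integral_ymSpecification_of_continuous ρ hρ β Λ hfm η,
    integral_ymSpecification_of_continuous ρ hρ β Λ hfm η']
  -- `F(ζ) = f (ζ η_{Λᶜ})` does not depend on the exterior datum: the central cell lies in `Λ`
  have hSΛ : cellEdges w 0 ⊆ Λ := cellEdges_subset_regionEdges w h0Y
  have hFeq : ∀ ζ : ↥Λ → G, f (glueWith Λ ζ η') = f (glueWith Λ ζ η) := fun ζ =>
    hf_cyl fun e he => by
      have heΛ : e ∈ Λ := hSΛ (Finset.mem_coe.1 he)
      rw [glueWith_apply_mem _ _ _ heΛ, glueWith_apply_mem _ _ _ heΛ]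
  have hNum' : (∫ ζ, f (glueWith Λ ζ η') * Real.exp (-β * wilsonBoundaryAction ρ Λ (glueWith Λ ζ η')) ∂π) =
      ∫ ζ, f (glueWith Λ ζ η) * Real.exp (-β * wilsonBoundaryAction ρ Λ (glueWith Λ ζ η')) ∂π :=
    integral_congr_ae (Filter.Eventually.of_forall fun ζ => by simp only [hFeq])
  rw [hNum']
  have hFm : Measurable fun ζ : ↥Λ → G => f (glueWith Λ ζ η) := hfm.comp (measurable_glueWith Λ η)
  have hF01 : ∀ ζ : ↥Λ → G, 0 ≤ f (glueWith Λ ζ η) ∧ f (glueWith Λ ζ η) ≤ 1 := fun ζ => hf01 _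
  obtain ⟨hlo, hhi⟩ := ratio_bounds π hFm hF01 (hwm η) (A := A) fun ζ => hwt _
  obtain ⟨hlo', hhi'⟩ := ratio_bounds π hFm hF01 (hwm η') (A := A) fun ζ => hwt _
  -- `m = ∫ F dπ ∈ [0, 1]`
  set m := ∫ ζ, f (glueWith Λ ζ η) ∂π with hm
  have hm0 : 0 ≤ m := integral_nonneg fun ζ => (hF01 ζ).1
  have hm1 : m ≤ 1 := by
    have hFi : Integrable (fun ζ : ↥Λ → G => f (glueWith Λ ζ η)) π :=
      Literature.MathematicalPhysics.QuantumLattice.integrable_of_bound hFm.aestronglyMeasurable (C := 1) fun ζ => by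
        rw [abs_le]; exact ⟨by linarith [(hF01 ζ).1], (hF01 ζ).2⟩
    have h := integral_mono hFi (integrable_const (1 : ℝ)) fun ζ => (hF01 ζ).2
    simpa using h
  have hUL : 0 ≤ Real.exp (2 * A) - Real.exp (-(2 * A)) :=
    sub_nonneg.2 (Real.exp_le_exp.2 (by linarith))
  have hgap : Real.exp (2 * A) - Real.exp (-(2 * A)) ≤ 8 * A := exp_gap_le hA0 h2A
  have hspan : (Real.exp (2 * A) - Real.exp (-(2 * A))) * m ≤ ε :=
    calc (Real.exp (2 * A) - Real.exp (-(2 * A))) * m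
          ≤ (Real.exp (2 * A) - Real.exp (-(2 * A))) * 1 := mul_le_mul_of_nonneg_left hm1 hUL
      _ ≤ ε := by rw [mul_one]; exact hgap.trans h8A
  exact abs_sub_le_of_bounds hlo hhi hlo' hhi' hspan

/-! ## §3 Format Uc in the strong-coupling window; mesh `1` is a Uc-mixing mesh there -/

/-- **Format Uc at `(b, n) = (1, 1)` for EVERY `δ` in the strong-coupling window** (class `Typ ≡ univ`). -/
theorem typShellCondUKPc_one_one_of_smallBeta (hρ : Continuous ρ) {ε : ℝ} (hε : 0 < ε) :
    ∃ β_D : ℝ, 0 < β_D ∧ ∀ β : ℝ, |β| ≤ β_D → ∀ δ : ℝ, TypShellCondUKPc ρ β 1 1 ε δ := by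
  obtain ⟨β_D, hβD, h⟩ := univShellCond_one_one_of_smallBeta ρ hρ hε
  exact ⟨β_D, hβD, fun β hβ δ => typShellCondUKPc_of_univShellCond (h β hβ) δ⟩

/-- **Mesh `1` is a Uc-mixing mesh in the strong-coupling window**: `1 ∈ {b | 1 ≤ b ∧ TypShellCondUKPc ρ β b 1 ε δ}`, so any
onset defined as the infimum of that set (the slot's `mixOnsetUc ρ β 1 ε δ = fmtOnset …`) equals `1` for `|β| ≤ β_D(ε)`. -/
theorem one_mem_fmtSetUc_of_smallBeta (hρ : Continuous ρ) {ε : ℝ} (hε : 0 < ε) :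
    ∃ β_D : ℝ, 0 < β_D ∧ ∀ β : ℝ, |β| ≤ β_D → ∀ δ : ℝ,
      (1 : ℕ) ∈ {b : ℕ | 1 ≤ b ∧ TypShellCondUKPc ρ β b 1 ε δ} ∧
        sInf {b : ℕ | 1 ≤ b ∧ TypShellCondUKPc ρ β b 1 ε δ} = 1 := by
  obtain ⟨β_D, hβD, h⟩ := typShellCondUKPc_one_one_of_smallBeta ρ hρ hε
  refine ⟨β_D, hβD, fun β hβ δ => ?_⟩
  have h1 : (1 : ℕ) ∈ {b : ℕ | 1 ≤ b ∧ TypShellCondUKPc ρ β b 1 ε δ} := ⟨le_rfl, h β hβ δ⟩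
  refine ⟨h1, le_antisymm (Nat.sInf_le h1) ?_⟩
  exact (Nat.sInf_mem ⟨1, h1⟩).1

end Summit.QuantumFields.YangMills.Cruxes.IR.AfPincerUc.Calibration

end
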